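import Literature.NumberTheory.LFunctions.LittlewoodZeroGapsInputs
import HarnessLib

/-!
# Littlewood's theorem on the gaps between zero ordinates of `ζ` — the chain of circles

Trunk T-ANT (`Literature/NumberTheory/LFunctions`).  Second of three files proving
`Literature.NumberTheory.LFunctions.littlewood_zero_ordinate_gaps_shrink` (Titchmarsh, *The Theory of the Riemann
Zeta-Function*, 2nd ed., Thm 9.11, by the first proof of §9.12 with a fixed width).  This file is the induction along the
chain of circles, eq. (9.12.1) and the three-circles recursion `M_ν ≤ M_{ν−1}^a 𝐌_ν^b`:

* `chain` — for `T ≥ 8`, `0 < h ≤ 1/8`, `n h = 7/2` and no zero of `ζ` in `−1 ≤ Re z ≤ 4`, `|Im z − T| ≤ 4h`: for every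
  `ν ≤ n` a holomorphic branch `L` of `log ζ` on `‖z − c_ν‖ < 4h`, `c_ν = 3 − νh + iT`, with `L' = ζ'/ζ`, `exp L = ζ`,
  `‖L‖ ≤ 8^{ν+1}(3 log(T+5) + 2)` on `‖z − c_ν‖ ≤ 3h` (Borel–Carathéodory) and
  `‖L‖ ≤ 2^{b^ν} (8^{n+1}(3 log(T+5)+2))^{1−b^ν}` on `‖z − c_ν‖ ≤ 2h` (three circles at radii `h, 3h, 4h`,
  `b = 1 − log 2/log 3`), consecutive branches agreeing on the overlap of their discs.

Geometry (differs from Titchmarsh only by scaling): radii `h, 2h, 3h, 4h` in place of `δ/4, δ/2, 3δ/4, δ`, centres marching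
from `3 + iT` to `−1/2 + iT` (the tree's growth bounds for `ζ` live on `Re ≥ −1`, so the chain stops at `σ = −1/2` rather
than `σ = −1`).  Sorry-free, standard axioms; no instances, no notation.  Provenance: cell rh-split, seat rh-split-typer-2 g4.
-/

noncomputable section

open Complex Metric Set Real Filter Topology

namespace Literature.NumberTheory.LFunctions

namespace LittlewoodZeroGaps

open Literature.NumberTheory.LFunctions.InvZetaRH (exists_log_of_ball norm_le_of_three_circles
  norm_riemannZeta_sub_one_le rho_lt_one)

/-- **The chain of circles.** Setting: `T ≥ 8`, `0 < h ≤ 1/8`, no zero of `ζ` in the box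
`−1 ≤ Re z ≤ 4`, `|Im z − T| ≤ 4h`; centres `c_ν = 3 − νh + iT` with `n h = 7/2`; `A = 3 log(T+5) + 2`,
`K = 8^{n+1}A`, `b = 1 − log 2/log 3`.  For every `ν ≤ n` there is a holomorphic branch `L` of `log ζ` on
the disc `‖z − c_ν‖ < 4h` with `‖L‖ ≤ 8^{ν+1}A` on `‖z − c_ν‖ ≤ 3h` and `‖L‖ ≤ 2^{b^ν} K^{1−b^ν}` on
`‖z − c_ν‖ ≤ 2h` (Borel–Carathéodory + Hadamard's three circles, iterated along the chain).
[cite: Titchmarsh1986, §9.12] -/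
theorem chain {T h : ℝ} {n : ℕ} (hT : 8 ≤ T) (hh : 0 < h) (hh8 : h ≤ 1 / 8)
    (hn : (n : ℝ) * h = 7 / 2)
    (hzf : ∀ z : ℂ, -1 ≤ z.re → z.re ≤ 4 → |z.im - T| ≤ 4 * h → riemannZeta z ≠ 0) :
    ∀ ν : ℕ, ν ≤ n →
      ∃ L : ℂ → ℂ, DifferentiableOn ℂ L (ball ((3 - ν * h : ℝ) + T * I) (4 * h)) ∧
        (∀ z ∈ ball ((3 - ν * h : ℝ) + T * I) (4 * h),
          HasDerivAt L (deriv riemannZeta z / riemannZeta z) z) ∧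
        (∀ z ∈ ball ((3 - ν * h : ℝ) + T * I) (4 * h), exp (L z) = riemannZeta z) ∧
        (∀ z : ℂ, ‖z - ((3 - ν * h : ℝ) + T * I)‖ ≤ 3 * h →
          ‖L z‖ ≤ 8 ^ (ν + 1) * (3 * Real.log (T + 5) + 2)) ∧
        (∀ z : ℂ, ‖z - ((3 - ν * h : ℝ) + T * I)‖ ≤ 2 * h →
          ‖L z‖ ≤ (2 : ℝ) ^ ((1 - Real.log 2 / Real.log 3) ^ ν) *
            ((8 : ℝ) ^ (n + 1) * (3 * Real.log (T + 5) + 2)) ^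
              (1 - (1 - Real.log 2 / Real.log 3) ^ ν)) := by
  -- abbreviations
  obtain ⟨A, hAdef⟩ : ∃ A : ℝ, A = 3 * Real.log (T + 5) + 2 := ⟨_, rfl⟩
  obtain ⟨K, hKdef⟩ : ∃ K : ℝ, K = (8 : ℝ) ^ (n + 1) * A := ⟨_, rfl⟩
  obtain ⟨b, hbdef⟩ : ∃ b : ℝ, b = 1 - Real.log 2 / Real.log 3 := ⟨_, rfl⟩
  simp only [← hAdef, ← hbdef]
  rw [← hKdef]
  have hb : 0 < b ∧ b < 1 := by rw [hbdef]; exact b_pos_lt_one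
  have hlogT : 2 ≤ Real.log (T + 5) := by
    rw [Real.le_log_iff_exp_le (by linarith)]
    have he := Real.exp_one_lt_d9
    have he0 := Real.exp_pos 1
    have h2 : Real.exp 2 = Real.exp 1 * Real.exp 1 := by rw [← Real.exp_add]; norm_num
    have h3 : Real.exp 1 * Real.exp 1 < 2.7182818286 * 2.7182818286 :=
      mul_lt_mul'' he he he0.le he0.le
    rw [h2]; linarith
  have hA8 : 8 ≤ A := by rw [hAdef]; linarith
  have hA0 : 0 < A := by linarith
  have h8pow : ∀ m : ℕ, (1 : ℝ) ≤ 8 ^ m := fun m ↦ one_le_pow₀ (by norm_num)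
  have hK1 : 1 ≤ K := by rw [hKdef]; nlinarith [h8pow (n + 1)]
  have hK0 : 0 < K := by linarith
  -- the centre as a function of `ν`
  set c : ℕ → ℂ := fun ν ↦ ((3 - ν * h : ℝ) : ℂ) + T * I with hc
  have hc_re : ∀ ν : ℕ, (c ν).re = 3 - ν * h := fun ν ↦ by simp [hc]
  have hc_im : ∀ ν : ℕ, (c ν).im = T := fun ν ↦ by simp [hc]
  have hc_succ : ∀ ν : ℕ, c (ν + 1) = c ν - h := fun ν ↦ by
    simp only [hc]; push_cast; ring
  -- geometry of the discs: inside the zero-free box, `Re ≥ -1`, `|Im| ≥ 1`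
  have hνh : ∀ ν : ℕ, ν ≤ n → (ν : ℝ) * h ≤ 7 / 2 := fun ν hν ↦ by
    calc (ν : ℝ) * h ≤ n * h := by gcongr
      _ = 7 / 2 := hn
  have hbox : ∀ ν : ℕ, ν ≤ n → ∀ z ∈ ball (c ν) (4 * h),
      -1 ≤ z.re ∧ z.re ≤ 4 ∧ |z.im - T| ≤ 4 * h ∧ 1 ≤ |z.im| ∧ |z.im| + 4 ≤ T + 5 := by
    intro ν hν z hz
    rw [mem_ball, dist_eq_norm] at hz
    have h1 := abs_re_le_norm (z - c ν)
    have h2 := abs_im_le_norm (z - c ν)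
    rw [sub_re, hc_re] at h1
    rw [sub_im, hc_im] at h2
    have hνh' := hνh ν hν
    have hνh0 : 0 ≤ (ν : ℝ) * h := by positivity
    have hre1 : -1 ≤ z.re := by
      have := neg_abs_le (z.re - (3 - ν * h)); linarith
    have hre2 : z.re ≤ 4 := by
      have := le_abs_self (z.re - (3 - ν * h)); linarith
    have him : |z.im - T| ≤ 4 * h := by linarith
    have him1 : T - 4 * h ≤ z.im := by have := neg_abs_le (z.im - T); linarith
    have him2 : z.im ≤ T + 4 * h := by have := le_abs_self (z.im - T); linarith
    have hzim : 0 < z.im := by linarith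
    have habs : |z.im| = z.im := abs_of_pos hzim
    have h4' : 1 ≤ |z.im| := by rw [habs]; linarith
    have h5' : |z.im| + 4 ≤ T + 5 := by rw [habs]; linarith
    exact ⟨hre1, hre2, him, h4', h5'⟩
  have hzf' : ∀ ν : ℕ, ν ≤ n → ∀ z ∈ ball (c ν) (4 * h), riemannZeta z ≠ 0 := by
    intro ν hν z hz
    obtain ⟨h1, h2, h3, -, -⟩ := hbox ν hν z hz
    exact hzf z h1 h2 h3
  have hreL : ∀ ν : ℕ, ν ≤ n → ∀ z ∈ ball (c ν) (4 * h), Real.log ‖riemannZeta z‖ ≤ A - 2 := by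
    intro ν hν z hz
    obtain ⟨h1, -, -, h4, h5⟩ := hbox ν hν z hz
    calc Real.log ‖riemannZeta z‖ ≤ 3 * Real.log (|z.im| + 4) := log_norm_zeta_le h1 h4
      _ ≤ 3 * Real.log (T + 5) := by gcongr
      _ = A - 2 := by rw [hAdef]; ring
  have hζball : ∀ ν : ℕ, ν ≤ n → DifferentiableOn ℂ riemannZeta (ball (c ν) (4 * h)) := by
    intro ν hν z hz
    have h1 : z ≠ 1 := by
      intro h1
      obtain ⟨-, -, -, h4, -⟩ := hbox ν hν z hz
      rw [h1] at h4; norm_num at h4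
    exact (differentiableAt_riemannZeta h1).differentiableWithinAt
  have h4h : (0 : ℝ) < 4 * h := by positivity
  -- small-ball inclusions (norm form)
  have hmem_of_le : ∀ (w u : ℂ) (r : ℝ), ‖w - u‖ ≤ r → r < 4 * h → w ∈ ball u (4 * h) := by
    intro w u r hw hr; rw [mem_ball, dist_eq_norm]; linarith
  -- induction on `ν`
  intro ν
  induction ν with
  | zero =>
    intro _
    have h0n : 0 ≤ n := Nat.zero_le _
    obtain ⟨L, hLd, hLc, hLder, hexp⟩ := exists_log_of_ball h4h (hζball 0 h0n) (hzf' 0 h0n)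
    -- `L = log ∘ ζ` on the first disc (Re ≥ 2 there)
    have hre2 : ∀ z ∈ ball (c 0) (4 * h), 2 ≤ z.re := by
      intro z hz
      rw [mem_ball, dist_eq_norm] at hz
      have h1 := abs_re_le_norm (z - c 0)
      rw [sub_re, hc_re] at h1
      have := neg_abs_le (z.re - (3 - ((0 : ℕ) : ℝ) * h))
      push_cast at this h1; linarith
    have hslit : ∀ z ∈ ball (c 0) (4 * h), riemannZeta z ∈ slitPlane := by
      intro z hz
      have h := mem_slitPlane_of_norm_lt_one (z := riemannZeta z - 1)
        ((norm_riemannZeta_sub_one_le (hre2 z hz)).trans_lt rho_lt_one)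
      rwa [add_sub_cancel] at h
    have heq : ∀ z ∈ ball (c 0) (4 * h), L z = log (riemannZeta z) := by
      have hVo : IsOpen (ball (c 0) (4 * h)) := isOpen_ball
      have hVc : IsPreconnected (ball (c 0) (4 * h)) := (convex_ball _ _).isPreconnected
      have hζat : ∀ z ∈ ball (c 0) (4 * h), DifferentiableAt ℂ riemannZeta z := fun z hz ↦
        (hζball 0 h0n).differentiableAt (isOpen_ball.mem_nhds hz)
      have hlogd : DifferentiableOn ℂ (fun z ↦ log (riemannZeta z)) (ball (c 0) (4 * h)) :=
        fun z hz ↦ ((hζat z hz).clog (hslit z hz)).differentiableWithinAt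
      have hder : (ball (c 0) (4 * h)).EqOn (deriv L) (deriv fun z ↦ log (riemannZeta z)) := by
        intro z hz
        rw [(hLder z hz).deriv, ((hζat z hz).hasDerivAt.clog (hslit z hz)).deriv]
      exact hVo.eqOn_of_deriv_eq hVc hLd hlogd hder (mem_ball_self h4h) hLc
    have hL2 : ∀ z ∈ ball (c 0) (4 * h), ‖L z‖ ≤ 2 := fun z hz ↦ by
      rw [heq z hz]; exact norm_log_zeta_le_two (hre2 z hz)
    refine ⟨L, hLd, hLder, hexp, ?_, ?_⟩
    · intro z hz
      have hz' : z ∈ ball (c 0) (4 * h) := hmem_of_le z (c 0) (3 * h) (by simpa [hc] using hz) (by linarith)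
      calc ‖L z‖ ≤ 2 := hL2 z hz'
        _ ≤ 8 ^ (0 + 1) * A := by norm_num; linarith
    · intro z hz
      have hz' : z ∈ ball (c 0) (4 * h) := hmem_of_le z (c 0) (2 * h) (by simpa [hc] using hz) (by linarith)
      calc ‖L z‖ ≤ 2 := hL2 z hz'
        _ = (2 : ℝ) ^ (b ^ 0) * K ^ (1 - b ^ 0) := by simp
  | succ ν ih =>
    intro hν
    have hν' : ν ≤ n := Nat.le_of_succ_le hν
    obtain ⟨L, hLd, hLder, hLexp, hL3, hL2⟩ := ih hν'
    -- the two centres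
    have hcν : ((3 - (ν : ℕ) * h : ℝ) : ℂ) + T * I = c ν := rfl
    have hcν1 : ((3 - ((ν + 1 : ℕ) : ℝ) * h : ℝ) : ℂ) + T * I = c (ν + 1) := rfl
    rw [hcν] at hLd hLder hLexp hL3 hL2
    rw [hcν1]
    set c' : ℂ := c (ν + 1) with hc'
    have hcc' : c' = c ν - h := hc_succ ν
    have hdist : ‖c' - c ν‖ = h := by
      rw [hcc', sub_sub_cancel_left, norm_neg, Complex.norm_real, Real.norm_eq_abs, abs_of_pos hh]
    -- the new log, normalised at the new centre to agree with `L`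
    obtain ⟨L₀, hL₀d, -, hL₀der, hL₀exp⟩ := exists_log_of_ball h4h (hζball (ν + 1) hν) (hzf' (ν + 1) hν)
    have hc'L : c' ∈ ball (c ν) (4 * h) := hmem_of_le c' (c ν) h hdist.le (by linarith)
    set L' : ℂ → ℂ := fun z ↦ L₀ z + (L c' - L₀ c') with hL'
    have hL'd : DifferentiableOn ℂ L' (ball c' (4 * h)) := hL₀d.add_const _
    have hL'der : ∀ z ∈ ball c' (4 * h), HasDerivAt L' (deriv riemannZeta z / riemannZeta z) z :=
      fun z hz ↦ (hL₀der z hz).add_const _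
    have hL'exp : ∀ z ∈ ball c' (4 * h), exp (L' z) = riemannZeta z := by
      intro z hz
      have h1 : exp (L c' - L₀ c') = 1 := by
        rw [Complex.exp_sub, hLexp c' hc'L, hL₀exp c' (mem_ball_self h4h),
          div_self (hzf' (ν + 1) hν c' (mem_ball_self h4h))]
      show exp (L₀ z + (L c' - L₀ c')) = riemannZeta z
      rw [Complex.exp_add, h1, mul_one, hL₀exp z hz]
    have hL'c : L' c' = L c' := by show L₀ c' + (L c' - L₀ c') = L c'; ring
    -- agreement of `L'` and `L` on the overlap
    have hagree : ∀ z ∈ ball c' (4 * h) ∩ ball (c ν) (4 * h), L' z = L z := by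
      set V : Set ℂ := ball c' (4 * h) ∩ ball (c ν) (4 * h) with hV
      have hVo : IsOpen V := isOpen_ball.inter isOpen_ball
      have hVc : IsPreconnected V := ((convex_ball _ _).inter (convex_ball _ _)).isPreconnected
      have hder : V.EqOn (deriv L') (deriv L) := by
        intro z hz; rw [(hL'der z hz.1).deriv, (hLder z hz.2).deriv]
      exact hVo.eqOn_of_deriv_eq hVc (hL'd.mono inter_subset_left) (hLd.mono inter_subset_right) hder
        ⟨mem_ball_self h4h, hc'L⟩ hL'c
    -- real parts: `Re L' = log ‖ζ‖ ≤ A - 2`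
    have hL're : ∀ z ∈ ball c' (4 * h), (L' z).re ≤ A := by
      intro z hz
      have : (L' z).re = Real.log ‖riemannZeta z‖ := by rw [← hL'exp z hz, norm_exp, Real.log_exp]
      rw [this]; linarith [hreL (ν + 1) hν z hz]
    -- (a) Borel–Carathéodory on the new disc
    have hc'3 : ‖L c'‖ ≤ 8 ^ (ν + 1) * A := hL3 c' (by rw [hdist]; linarith)
    have hL'3 : ∀ z : ℂ, ‖z - c'‖ ≤ 3 * h → ‖L' z‖ ≤ 8 ^ (ν + 1 + 1) * A := by
      intro z hz
      have h1 := norm_le_of_re_le hh hA0 hL'd hL're hz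
      rw [hL'c] at h1
      calc ‖L' z‖ ≤ 6 * A + 7 * ‖L c'‖ := h1
        _ ≤ 6 * A + 7 * (8 ^ (ν + 1) * A) := by linarith
        _ ≤ 8 ^ (ν + 1 + 1) * A := by
            have h8 : (8 : ℝ) ≤ 8 ^ (ν + 1) := by
              calc (8 : ℝ) = 8 ^ 1 := by norm_num
                _ ≤ 8 ^ (ν + 1) := pow_le_pow_right₀ (by norm_num) (by omega)
            have e : (8 : ℝ) ^ (ν + 1 + 1) = 8 * 8 ^ (ν + 1) := by ring
            rw [e]
            nlinarith [mul_le_mul_of_nonneg_right h8 hA0.le]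
    -- (b) three circles on the new disc: inner radius `h` (inside the old `2h`-disc), outer `3h`
    have hM1 : ∀ z : ℂ, ‖z - c'‖ = h → ‖L' z‖ ≤ (2 : ℝ) ^ (b ^ ν) * K ^ (1 - b ^ ν) := by
      intro z hz
      have hz2 : ‖z - c ν‖ ≤ 2 * h := by
        calc ‖z - c ν‖ = ‖(z - c') + (c' - c ν)‖ := by rw [sub_add_sub_cancel]
          _ ≤ ‖z - c'‖ + ‖c' - c ν‖ := norm_add_le _ _
          _ = 2 * h := by rw [hz, hdist]; ring
      have hzV : z ∈ ball c' (4 * h) ∩ ball (c ν) (4 * h) :=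
        ⟨hmem_of_le z c' h hz.le (by linarith), hmem_of_le z (c ν) (2 * h) hz2 (by linarith)⟩
      rw [hagree z hzV]
      exact hL2 z hz2
    have hM3 : ∀ z : ℂ, ‖z - c'‖ = 3 * h → ‖L' z‖ ≤ K := by
      intro z hz
      calc ‖L' z‖ ≤ 8 ^ (ν + 1 + 1) * A := hL'3 z hz.le
        _ ≤ 8 ^ (n + 1) * A := by
            have : (8 : ℝ) ^ (ν + 1 + 1) ≤ 8 ^ (n + 1) := pow_le_pow_right₀ (by norm_num) (by omega)
            nlinarith
        _ = K := hKdef.symm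
    have hM1nn : 0 ≤ (2 : ℝ) ^ (b ^ ν) * K ^ (1 - b ^ ν) := by positivity
    have hsphere2 : ∀ z : ℂ, ‖z - c'‖ = 2 * h → ‖L' z‖ ≤ (2 : ℝ) ^ (b ^ (ν + 1)) * K ^ (1 - b ^ (ν + 1)) := by
      intro z hz
      have h3c := norm_le_of_three_circles (F := L') (c := c') (R := 4 * h) (r₁ := h) (r₃ := 3 * h)
        hh (by linarith) (by linarith) hL'd hM1 hM3 (z := z) (by rw [hz]; linarith) (by rw [hz]; linarith)
      have hexp1 : Real.log (‖z - c'‖ / h) / Real.log (3 * h / h) = 1 - b := by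
        rw [hz, show 2 * h / h = 2 by field_simp, show 3 * h / h = 3 by field_simp, hbdef]; ring
      rw [hexp1, show 1 - (1 - b) = b by ring] at h3c
      calc ‖L' z‖ ≤ ((2 : ℝ) ^ (b ^ ν) * K ^ (1 - b ^ ν)) ^ b * K ^ (1 - b) := h3c
        _ = (2 : ℝ) ^ (b ^ ν * b) * K ^ ((1 - b ^ ν) * b + (1 - b)) := by
            rw [Real.mul_rpow (by positivity) (by positivity), ← Real.rpow_mul (by norm_num),
              ← Real.rpow_mul hK0.le, mul_assoc, ← Real.rpow_add hK0]
        _ = (2 : ℝ) ^ (b ^ (ν + 1)) * K ^ (1 - b ^ (ν + 1)) := by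
            have e1 : b ^ ν * b = b ^ (ν + 1) := (pow_succ b ν).symm
            have e2 : (1 - b ^ ν) * b + (1 - b) = 1 - b ^ (ν + 1) := by rw [pow_succ]; ring
            rw [e1, e2]
    refine ⟨L', hL'd, hL'der, hL'exp, hL'3, ?_⟩
    intro z hz
    exact norm_le_of_sphere_bound (by positivity) (by linarith : 2 * h < 4 * h) hL'd hsphere2 hz

end LittlewoodZeroGaps

end Literature.NumberTheory.LFunctions

end
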